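import Summits.BirchSwinnertonDyer.BirchSwinnertonDyer.Theorems.KimAtThreeDeepUpperNonAdditiveAllOfFineKato
import Summits.BirchSwinnertonDyer.BirchSwinnertonDyer.Theorems.KimAtThreeDeepUpperCertSupplyNonAdditive
import Summits.BirchSwinnertonDyer.BirchSwinnertonDyer.Theorems.KimAtThreeKolyvaginIsogenyCruxes
import HarnessLib

/-!
# Route `KimAtThreeKolyvagin` (rung W2): crux `DeepUpperAtThree` (19076) and its child 19562 BY NAME from
# S24-DEEP ×2 + GZK + Poitou–Tate (+ Carayol) and ONE UNIFORM fine Kato package — EVERY tower row, EVERY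
# reduction type at `3`, ONE coordinate (cell `bsd-addord`, seat w2-c3 gen 6)

HONEST FRAMING: glue/END-type theorems with DISPLAYED hypotheses (no definition, no named fact, no `sorry`); the
conclusions are route decls BY NAME but CONDITIONAL on the displayed package (C1ᵤ), so NOTHING is closed and
nothing is booked; BSD is not proved by any of this.

## What, and why

This seat's glue `KimAtThreeDeepUpperOfFineKatos` (p486669) derives 19076 from the PUBLISHED leaves and THREE fine
Kato packages in three coordinates (⟨C1⟩ Kato stratum via kim3's PORT″/(C3)/stub apparatus and the pinned
Sakamoto facts; (C1ₜₑ) additive-defect; (C1₃) good/multiplicative).  But the road built for the non-additive rows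
is itself reduction-blind: THEOREM D-u on `hstab` (p481003), the shifted-exponent family (p483706), the value
rows with the `3`-Euler factor in the twist and augmentation `3^α·unit` (p481881/p483498/p483750), the
class-wide certificate supply `certSupply₃'` (p485332 — its proof never used `¬ Addv`; on additive rows
`a₃ = 0`, `E₃(1) = 1`, `β = 1`), and seat w2-acc1's END (p461725).  So ONE package in ONE coordinate serves
EVERY row — the Kato stratum included, with NO PORT″, NO stub, NO (C3), NO SAT₀, and only the S24-DEEP pair:
(C1ᵤ) for a tower-surjective `W`, a place `v₃ ∣ 3` and a lattice-optimal datum `P` at the conductor: Kato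
witnesses `(ι, κK, Λ)` of the `ZetaBody` family with `κK` rational of `3`-valuation `κe ≥ 1` (coordinate
`Λ = 3^{κe}·(unit)·exp*_ω`; `κe = 1 + v₃(c_P)`-type bookkeeping is absorbed), functionals `Λfin j` with the
(Λ)-clauses and the two-exponent riders (ii₂) at `(j, t, e)` — TRUE for Kato's witnesses with `t = 0`,
`e = κe − 1 + v₃(#Ẽ_ns(𝔽₃)·c₃) − τ` by the crude bound `3·exp*_ω(H¹(K,T)) ⊆ 𝒪_K` (`K/ℚ₃` unramified).
* `portFamilyDeep_of_fineKatoUniform` — acc1's displayed port-family shape on EVERY tower row ⟸ (C1ᵤ) + the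
  certificate-supply shape (C2ᵤ) (= `certSupply₃'`'s conclusion, with `β`); combined certificate
  `α = κe + β − 1`, witnesses at exponent `t + α`.
* `deepUpper_optimalRow_of_deepFacts_of_fineKatoUniform` — 19076's conclusion at EVERY tower row with `Ш`
  finite and a lattice-optimal datum at the conductor with `3`-integral plus symbols and `ord(δ̃) = 0` ⟸
  S24-DEEP ×2, GZK, Poitou–Tate, (C1ᵤ) — (C2ᵤ) DISCHARGED by `certSupply₃'`.
* (crux 19562 BY NAME follows verbatim from the row theorem; not restated — cf. `KimAtThreeDeepUpperOfFineKatos`.)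
* ★ `deepUpperAtThree_of_deepFacts_of_fineKatoUniform` — **crux 19076 `DeepUpperAtThree` BY NAME ⟸ S24-DEEP ×2,
  GZK, Poitou–Tate, Carayol (kim3's transport to optimal data at the conductor) and (C1ᵤ) ALONE.**
HONEST LIMITS: (C1ᵤ) is construction-shaped (axioms on bound witnesses; model = Kato Thm 9.7 ∘ 6.6 (1) + [BK90]
Prop. 3.8 / Ex. 3.11 + Kim AJM Lemma 3.4 — the planner's definition item `defn-BlochKatoDualExponential`); the
four leaves are cite-only named facts; nothing is closed.
References: [Kato2004Asterisque] (8.1.3), Prop. 8.12, §9.4, Thm. 9.7, Thm. 6.6 (1), Ex. 13.3;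
[Kim2022StructureSelmer] Lemma 3.4, Thm. 3.13, §2.2.2; [Kim2025RefinedTNC] Thm 1.1; [MazurRubin2004] Thm. 3.2.4, App.
A; [Sakamoto2024] Thm. 4.4; [MilneADT2006] I.4.10; [Carayol1986]; this seat's memo W2C3-UNIFORM-PORT-g6. -/

set_option autoImplicit false
-- the Theorems namespace of a single-conjunct summit repeats the summit name by design (D-0017)
set_option linter.dupNamespace false

noncomputable section

open scoped NumberField TensorProduct ContRepresentation Classical
open CategoryTheory Field Function Finset IsDedekindDomain NumberField WeierstrassCurve
open Rat.HeightOneSpectrum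
open Literature.NumberTheory.GaloisRepresentations Literature.NumberTheory.GaloisCohomology
open Literature.NumberTheory.GaloisRepresentations.DiscreteGaloisModule
open Literature.NumberTheory.EllipticCurves Literature.NumberTheory.EllipticCurves.ModularForms
open Literature.NumberTheory.EllipticCurves.Rank1Residual
open Literature.NumberTheory.EllipticCurves.Kato2004
open Literature.NumberTheory.EllipticCurves.Kato2004.EulerSystemValues
open Summit.BirchSwinnertonDyer.Rank1Residual.GaloisImage
open Summit.BirchSwinnertonDyer.BirchSwinnertonDyer.Theses.KimAtThreeKolyvagin
open Summit.BirchSwinnertonDyer.BirchSwinnertonDyer.Theorems.KimAtThreeDeepUpperAdditiveDefectOfPortEDeep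

open Summit.BirchSwinnertonDyer.BirchSwinnertonDyer.Theorems.KimAtThreeDeepUpperWitnessOfZetaBodyPow
open Summit.BirchSwinnertonDyer.BirchSwinnertonDyer.Theorems.KimAtThreeDeepUpperValueRowsAnomalous

open Summit.BirchSwinnertonDyer.BirchSwinnertonDyer.Theorems.KimAtThreeDeepUpperNonAdditiveAllOfFineKato

namespace Summit.BirchSwinnertonDyer.BirchSwinnertonDyer.Theorems.KimAtThreeDeepUpperUniformOfFineKato

/-- Local notation: the TWO-EXPONENT rider clause (ii₂) at depth `j`, torsion exponent `t`, defect exponent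
`e`, place `v`, for the pair `(Λ, Λf)` — seat acc6's spelling (`KimAtThreeTwoExponentWitnessPair`). -/
local notation3 (prettyPrint := false) "RIDER₂⟦" W' ", " j ", " t' ", " e' ", " v' ", " Λ' ", " Λf "⟧" =>
  ∀ (r : Finset (HeightOneSpectrum (𝓞 ℚ)))
    (Ψ : H1 (tateRep W' 3) (cycSubgroup 3 0 r) →+
      continuousCohomology 1
        (subgroupRep (WeierstrassCurve.torsionGaloisModule W' (((3 : ℕ) : ℤ) ^ j * ((3 : ℕ) : ℤ))).toTopRep
          (cycSubgroup 3 0 r))),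
    (∀ (φ : contOneCocycles (subgroupRep (tateRep W' 3).toTopRep (cycSubgroup 3 0 r)))
        (ψ : contOneCocycles
          (subgroupRep (WeierstrassCurve.torsionGaloisModule W' (((3 : ℕ) : ℤ) ^ j * ((3 : ℕ) : ℤ))).toTopRep
            (cycSubgroup 3 0 r))),
        (∀ g, ((ψ.1 g : geomTorsion W' (((3 : ℕ) : ℤ) ^ j * ((3 : ℕ) : ℤ))) : geomPoints W') =
          TateModule.proj 3 (j + 1) (φ.1 g)) →
        Ψ (oneCocycleClass _ φ) = oneCocycleClass _ ψ) →
    ∀ (y : H1 (tateRep W' 3) (cycSubgroup 3 0 r))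
      (κ₀ : galoisCohomology (WeierstrassCurve.torsionGaloisModule W' (((3 : ℕ) : ℤ) ^ j * ((3 : ℕ) : ℤ))) 1)
      (s : ℤ_[3]),
      resSubgroup (WeierstrassCurve.torsionGaloisModule W' (((3 : ℕ) : ℤ) ^ j * ((3 : ℕ) : ℤ))).toTopRep
          (cycSubgroup 3 0 r) 1 κ₀ = Ψ y →
      galoisCohomology.localization (WeierstrassCurve.torsionGaloisModule W' (((3 : ℕ) : ℤ) ^ j * ((3 : ℕ) : ℤ)))
          (Sum.inr v') 1 κ₀ ∈ propagatedSelmerStructure W' 3 j (Sum.inr v') →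
      (∃ l ∈ cycIntLattice 3 (cycLevel 3 0 r),
          (((3 : ℕ) : ℤ_[3]) ^ t') • Λ' 0 r y - ((s : ℚ_[3]) ⊗ₜ[ℚ] (1 : CyclotomicField (cycLevel 3 0 r) ℚ)) =
            (((3 : ℕ) : ℤ_[3]) ^ (j + 1)) • (l : ℚ_[3] ⊗[ℚ] CyclotomicField (cycLevel 3 0 r) ℚ)) →
      ((3 ^ e' : ℕ) : ZMod (3 ^ (j + 1))) *
        Λf (galoisCohomology.localization
          (WeierstrassCurve.torsionGaloisModule W' (((3 : ℕ) : ℤ) ^ j * ((3 : ℕ) : ℤ))) (Sum.inr v') 1 κ₀) =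
        PadicInt.toZModPow (j + 1) s

/-! ### §0 The certificate supply on EVERY row (this seat's `certSupply₃'` minus its idle `¬ Addv` binder) -/

/-- **(C2ᵤ) — Kato's auxiliary cusp datum with guards, the cusp certificate and the depletion certificate
`v₃(∏_{q∣3A}E_q(1)) = β − 1`, for EVERY `W` with `ρ̄_{E,3}` onto and EVERY datum `P`** (`unitMinusSymbol_row₃` ∘
`certSupply_row_of_unitMinusSymbol₃`; `β = v₃(3 − a₃ + 𝟙_{3∤N})`: `1` on additive and anomalous rows, `0` else).
[cite: Kato2004Asterisque, Thm. 6.6 (1) (p. 163) and Ex. 13.3 (pp. 224–225)] [cite: TateGCFT1967, §2.4 (Tchebotarev density theorem)] -/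
theorem certSupply_uniform (W : WeierstrassCurve ℚ) [W.IsElliptic] [W.IsGloballyMinimal]
    (htow : ∀ m : ℕ, W.HasSurjectiveModNGaloisRep (3 ^ m : ℕ))
    {N : ℕ} [NeZero N] (P : ModularParametrizationData W N) :
    ∃ (c d a : ℤ) (A : ℕ) (d' : ℤ) (aM : ℕ → ℤ) (β : ℕ),
      0 < A ∧ Int.gcd c (6 * 3 * A) = 1 ∧ Int.gcd d (6 * 3 * N) = 1 ∧
      (∀ q : ℕ, q.Prime → q ≡ 1 [MOD 3] → ¬ q ∣ 2 * c.natAbs * d.natAbs * A) ∧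
      Int.gcd (c * d) A = 1 ∧ d * d' ≡ 1 [ZMOD (A : ℤ)] ∧ Nat.Coprime A N ∧
      (∀ q ∈ (3 * A).primeFactors, cuspCoeff P.f q = aM q) ∧
      (∏ q ∈ (3 * A).primeFactors,
          (1 - (aM q : ℚ) / q + (if q ∣ N then 0 else (1 / q : ℚ))) ≠ 0) ∧
      padicValRat 3 (∏ q ∈ (3 * A).primeFactors,
          (1 - (aM q : ℚ) / q + (if q ∣ N then 0 else (1 / q : ℚ)))) = (β : ℤ) - 1 ∧
      ((c : ℚ) ^ 2 * (d : ℚ) ^ 2 * ratMinusSymbol P.f ((a : ℚ) / A) -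
          (c : ℚ) * (d : ℚ) ^ 2 * ratMinusSymbol P.f ((a * c : ℚ) / A) -
          (c : ℚ) ^ 2 * (d : ℚ) * ratMinusSymbol P.f ((a * d' : ℚ) / A) +
          (c : ℚ) * (d : ℚ) * ratMinusSymbol P.f ((a * c * d' : ℚ) / A) ≠ 0) ∧
      padicValRat 3 ((c : ℚ) ^ 2 * (d : ℚ) ^ 2 * ratMinusSymbol P.f ((a : ℚ) / A) -
          (c : ℚ) * (d : ℚ) ^ 2 * ratMinusSymbol P.f ((a * c : ℚ) / A) -
          (c : ℚ) ^ 2 * (d : ℚ) * ratMinusSymbol P.f ((a * d' : ℚ) / A) +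
          (c : ℚ) * (d : ℚ) * ratMinusSymbol P.f ((a * c * d' : ℚ) / A)) = 0 := by
  have hs : W.HasSurjectiveModNGaloisRep (3 : ℕ) := by simpa using htow 1
  obtain ⟨q, n, t, a₀, hq, hq3, hqN, hn, ht, h3t, hX0, hX⟩ :=
    KimAtThreeDeepUpperUnitMinusSymbolAnyLevel.unitMinusSymbol_row₃ W hs P
  exact KimAtThreeDeepUpperCertSupplyNonAdditive.certSupply_row_of_unitMinusSymbol₃ W P
    (KimAtThreeDeepUpperCertSupplyNonAdditive.three_sub_LFunction_add_ne_zero W P) hq hq3 hqN hn ht h3t hX0 hX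

/-! ### §1 EVERY tower row: acc1's port family from (C1ᵤ) + (C2ᵤ) -/

section Uniform

variable
  -- (C1ᵤ) the UNIFORM fine Kato package: coordinate `Λ = 3^{κe}·exp*_ω` (`v₃(κK) = κe ≥ 1`), rider clause (ii₂)
  -- at the row's exponents `(t, e)` — EVERY tower row, EVERY reduction type at `3`
  (hC1 : ∀ (W : WeierstrassCurve ℚ) [W.IsElliptic] [W.IsGloballyMinimal]
    [ContinuousSMul ℤ_[3] (W.tateModule 3)] [Module.Free ℤ_[3] (W.tateModule 3)]
    [Module.Finite ℤ_[3] (W.tateModule 3)],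
    (∀ m : ℕ, W.HasSurjectiveModNGaloisRep (3 ^ m : ℕ)) →
    ∀ (v₃ : HeightOneSpectrum (𝓞 ℚ)), ((3 : ℕ) : 𝓞 ℚ) ∈ v₃.asIdeal →
    ∀ {N : ℕ} [NeZero N] (P : ModularParametrizationData W N), N = W.conductorNorm ℤ →
      (∀ z ∈ P.L.lattice, ∃ w ∈ periodLattice P.f, z = P.c * w) →
      ∃ (t e κe : ℕ) (ι : (n : ℕ) → (CyclotomicField n ℚ →+* ℂ)) (κK : ℝ)
        (Λ : ∀ (k' : ℕ) (r : Finset (HeightOneSpectrum (𝓞 ℚ))),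
          H1 (tateRep W 3) (cycSubgroup 3 k' r) →ₗ[ℤ_[3]] ℚ_[3] ⊗[ℚ] CyclotomicField (cycLevel 3 k' r) ℚ)
        (Λfin : ∀ j : ℕ, galoisCohomology
          ((W.torsionGaloisModule (((3 : ℕ) : ℤ) ^ j * ((3 : ℕ) : ℤ))).toLocal (Sum.inr v₃)) 1 →+
            ZMod (3 ^ (j + 1))),
        κK ≠ 0 ∧ (∃ u : ℚ, (u : ℝ) = κK ∧ padicValRat 3 u = κe ∧ 1 ≤ κe) ∧
        (∀ j : ℕ,
          (∀ c : ZMod (3 ^ (j + 1)), ∃ x ∈ propagatedSelmerStructure W 3 j (Sum.inr v₃), Λfin j x = c) ∧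
          (∀ x ∈ propagatedSelmerStructure W 3 j (Sum.inr v₃),
            Λfin j x = 0 ↔ x ∈ W.kummerSelmerStructure (((3 : ℕ) : ℤ) ^ j * ((3 : ℕ) : ℤ)) (Sum.inr v₃))) ∧
        (∀ j : ℕ, RIDER₂⟦W, j, t, e, v₃, Λ, Λfin j⟧) ∧
        ∀ (c d a : ℤ) (A : ℕ), 0 < A → Int.gcd c (6 * 3 * A) = 1 → Int.gcd d (6 * 3 * N) = 1 →
          ∃ (z : ∀ (k' : ℕ) (r : (cyclotomicLevelsRat 3 (badPlaces c d A N)).Ideals),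
                H1 (tateRep W 3) ((cyclotomicLevelsRat 3 (badPlaces c d A N)).level k' r.1))
            (x : ∀ (k' : ℕ) (r : (cyclotomicLevelsRat 3 (badPlaces c d A N)).Ideals),
                CyclotomicField (cycLevel 3 k' r.1) ℚ),
            ZetaBody W 3 P.f ι κK Λ c d a A z x)

include hC1


/-- **acc1's displayed port family on EVERY tower row, from (C1ᵤ) + (C2ᵤ)** — per row: (C2ᵤ) gives Kato's
auxiliary datum, its certificates and `β`, (C1ᵤ) gives `(t, e, κe, ι, κK, Λ, Λfin)` and `ZetaBody` for that datum,
`v₃(κK) = κe ≥ 1` makes `uκ·a₃/3`, `uκ·𝟙/3` integral and — with the depletion certificate `β − 1` — the combined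
certificate `α = κe + β − 1`; then the companion's `deepWitnessFamily_of_zetaBody_of_valueRows_pow` (shift `N₀` of
the row, exponent `t + α`).  Instance binders of the
Tate module are discharged by the tree's `_holds` theorems; `E[3]` is irreducible under the tower.  Closes
nothing; (C1₃)/(C2₃) stay displayed.
[cite: Kato2004Asterisque, (8.1.3) (p. 180), §9.4 (p. 188), Thm. 9.7 (p. 189) and Ex. 13.3 (pp. 224–225)]
[cite: Kim2022StructureSelmer, Thm. 3.13, Lemma 3.4 and §2.2.2] [cite: MazurRubin2004, App. A Prop. A.2] -/
theorem portFamilyDeep_of_fineKatoUniform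
    (hC2 : ∀ (W : WeierstrassCurve ℚ) [W.IsElliptic] [W.IsGloballyMinimal],
      (∀ m : ℕ, W.HasSurjectiveModNGaloisRep (3 ^ m : ℕ)) →
      ∀ {N : ℕ} [NeZero N] (P : ModularParametrizationData W N), N = W.conductorNorm ℤ →
        (∀ z ∈ P.L.lattice, ∃ w ∈ periodLattice P.f, z = P.c * w) →
        ∃ (c d a : ℤ) (A : ℕ) (d' : ℤ) (aM : ℕ → ℤ) (α : ℕ),
          0 < A ∧ Int.gcd c (6 * 3 * A) = 1 ∧ Int.gcd d (6 * 3 * N) = 1 ∧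
          (∀ q : ℕ, q.Prime → q ≡ 1 [MOD 3] → ¬ q ∣ 2 * c.natAbs * d.natAbs * A) ∧
          Int.gcd (c * d) A = 1 ∧ d * d' ≡ 1 [ZMOD (A : ℤ)] ∧ Nat.Coprime A N ∧
          (∀ q ∈ (3 * A).primeFactors, cuspCoeff P.f q = aM q) ∧
          (∏ q ∈ (3 * A).primeFactors,
              (1 - (aM q : ℚ) / q + (if q ∣ N then 0 else (1 / q : ℚ))) ≠ 0) ∧
          padicValRat 3 (∏ q ∈ (3 * A).primeFactors,
              (1 - (aM q : ℚ) / q + (if q ∣ N then 0 else (1 / q : ℚ)))) = (α : ℤ) - 1 ∧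
          ((c : ℚ) ^ 2 * (d : ℚ) ^ 2 * ratMinusSymbol P.f ((a : ℚ) / A) -
              (c : ℚ) * (d : ℚ) ^ 2 * ratMinusSymbol P.f ((a * c : ℚ) / A) -
              (c : ℚ) ^ 2 * (d : ℚ) * ratMinusSymbol P.f ((a * d' : ℚ) / A) +
              (c : ℚ) * (d : ℚ) * ratMinusSymbol P.f ((a * c * d' : ℚ) / A) ≠ 0) ∧
          padicValRat 3 ((c : ℚ) ^ 2 * (d : ℚ) ^ 2 * ratMinusSymbol P.f ((a : ℚ) / A) -
              (c : ℚ) * (d : ℚ) ^ 2 * ratMinusSymbol P.f ((a * c : ℚ) / A) -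
              (c : ℚ) ^ 2 * (d : ℚ) * ratMinusSymbol P.f ((a * d' : ℚ) / A) +
              (c : ℚ) * (d : ℚ) * ratMinusSymbol P.f ((a * c * d' : ℚ) / A)) = 0) :
    ∀ (W : WeierstrassCurve ℚ) [W.IsElliptic] [W.IsGloballyMinimal],
      (∀ m : ℕ, W.HasSurjectiveModNGaloisRep (3 ^ m : ℕ)) →
      ∀ (v₃ : HeightOneSpectrum (𝓞 ℚ)), ((3 : ℕ) : 𝓞 ℚ) ∈ v₃.asIdeal →
      ∀ (η : (q : HeightOneSpectrum (𝓞 ℚ)) → (ZMod (Ideal.absNorm q.asIdeal))ˣ),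
        (∀ q, Subgroup.zpowers (η q) = ⊤) →
      ∀ {N : ℕ} [NeZero N] (P : ModularParametrizationData W N), N = W.conductorNorm ℤ →
        (∀ z ∈ P.L.lattice, ∃ w ∈ periodLattice P.f, z = P.c * w) →
        ∃ t e : ℕ, ∀ (k : ℕ)
          (Dk : KolyvaginDatum (W.torsionGaloisModule (((3 : ℕ) : ℤ) ^ k * ((3 : ℕ) : ℤ)))),
          Dk.IsCanonicalTauDatumThreeAtWith W (k + t) k η →
          ∃ (κ : Finset (HeightOneSpectrum (𝓞 ℚ)) →
                galoisCohomology (W.torsionGaloisModule (((3 : ℕ) : ℤ) ^ k * ((3 : ℕ) : ℤ))) 1)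
            (Λ : galoisCohomology ((W.torsionGaloisModule (((3 : ℕ) : ℤ) ^ k * ((3 : ℕ) : ℤ))).toLocal
                (Sum.inr v₃)) 1 →+ ZMod (3 ^ (k + 1)))
            (κ' : Finset (HeightOneSpectrum (𝓞 ℚ)) →
                galoisCohomology (W.torsionGaloisModule (((3 : ℕ) : ℤ) ^ k * ((3 : ℕ) : ℤ))) 1),
            KatoKuriharaWitnessAt W k e Dk v₃ P κ Λ κ' := by
  intro W _ _ htow v₃ hv₃ η _hη N _ P hN hlat
  haveI : Fact (Nat.Prime 3) := ⟨Nat.prime_three⟩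
  haveI : ContinuousSMul ℤ_[3] (W.tateModule 3) := TateModule.continuousSMul_padicInt
  haveI : Module.Free ℤ_[3] (W.tateModule 3) := W.module_free_tateModule_holds 3
  haveI : Module.Finite ℤ_[3] (W.tateModule 3) := W.module_finite_tateModule_holds 3
  obtain ⟨c, d, a, A, d', aM, β, hApos, hcA, hdN, hcdA, hcd, hdd', hAN, haM, hE0, hE, hR0, hR⟩ :=
    hC2 W htow P hN hlat
  haveI : NeZero A := ⟨hApos.ne'⟩
  obtain ⟨t, e, κe, ι, κK, Λ, Λfin, hκ0, ⟨uκ, huκ, hvu, hκe⟩, hΛ, hfin₂, hz⟩ := hC1 W htow v₃ hv₃ P hN hlat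
  obtain ⟨z, x, hbody⟩ := hz c d a A hApos hcA hdN
  have hirr : W.HasIrreducibleModPGaloisRep 3 :=
    KimAtThreeKolyvaginPortShared.hasIrreducibleModPGaloisRep_three_of_tower W htow
  -- `v₃(uκ) = κe ≥ 1`: `uκ`, `uκ·a₃/3`, `uκ·𝟙/3` are `3`-integral; the combined certificate is `κe + β − 1`
  have huκ0 : uκ ≠ 0 := by rintro rfl; exact hκ0 (by rw [← huκ, Rat.cast_zero])
  have hnorm3 : ‖(uκ : ℚ_[3])‖ = (3 : ℝ) ^ (-(κe : ℤ)) := by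
    rw [Padic.norm_eq_zpow_neg_valuation (by exact_mod_cast huκ0), Padic.valuation_ratCast, hvu]
    norm_num
  have hnorm3le : ‖(uκ : ℚ_[3])‖ ≤ 3⁻¹ := by
    rw [hnorm3, show (3 : ℝ)⁻¹ = (3 : ℝ) ^ (-(1 : ℤ)) by norm_num]
    exact zpow_le_zpow_right₀ (by norm_num) (by omega)
  have huκ1 : ‖(uκ : ℚ_[3])‖ ≤ 1 := hnorm3le.trans (by norm_num)
  have hthird : ∀ m : ℤ, ‖((uκ * ((m : ℚ) / (3 : ℕ)) : ℚ) : ℚ_[3])‖ ≤ 1 := by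
    intro m
    rw [Rat.cast_mul, norm_mul, Rat.cast_div, norm_div, Rat.cast_intCast, Rat.cast_natCast, Nat.cast_ofNat]
    have h3 : ‖(3 : ℚ_[3])‖ = 3⁻¹ := by
      have := Padic.norm_p (p := 3)
      simpa using this
    rw [h3]
    have hm : ‖((m : ℤ) : ℚ_[3])‖ ≤ 1 := Padic.norm_int_le_one m
    have : ‖((m : ℤ) : ℚ_[3])‖ / 3⁻¹ = 3 * ‖((m : ℤ) : ℚ_[3])‖ := by field_simp
    rw [this]
    nlinarith [norm_nonneg ((m : ℤ) : ℚ_[3]), norm_nonneg (uκ : ℚ_[3])]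
  have hκa : ‖((uκ * ((aM 3 : ℚ) / (3 : ℕ)) : ℚ) : ℚ_[3])‖ ≤ 1 := hthird (aM 3)
  have hκ1 : ‖((uκ * (if 3 ∣ N then 0 else (1 / (3 : ℕ) : ℚ)) : ℚ) : ℚ_[3])‖ ≤ 1 := by
    by_cases h3N : 3 ∣ N
    · rw [if_pos h3N, mul_zero, Rat.cast_zero, norm_zero]; exact zero_le_one
    · rw [if_neg h3N]
      have h := hthird 1
      rw [Int.cast_one] at h
      exact h
  have hκE : padicValRat 3
      (uκ * ∏ q ∈ (3 * A).primeFactors, (1 - (aM q : ℚ) / q + (if q ∣ N then 0 else (1 / q : ℚ)))) =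
        ((κe + β - 1 : ℕ) : ℤ) := by
    rw [padicValRat.mul huκ0 hE0, hvu, hE, Nat.cast_sub (hκe.trans (Nat.le_add_right κe β))]
    push_cast
    ring
  obtain ⟨N₀, hfam⟩ := deepWitnessFamily_of_zetaBody_of_valueRows_pow W P hN hbody hirr hv₃ Λfin hΛ
    hfin₂ hcdA uκ huκ hκ0 huκ1 d' hcd hdd' hAN aM haM hκa hκ1 hE0 hκE hR0 hR
  exact ⟨N₀, t + (κe + β - 1), hfam⟩

/-- **Crux 19076's conclusion at EVERY tower row with `Ш` finite and a lattice-optimal datum at the conductor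
(`3`-integral plus symbols, `ord(δ̃) = 0`), from S24-DEEP ×2, GZK, Poitou–Tate and (C1ᵤ) ALONE** — (C2ᵤ) is this
seat's THEOREM `certSupply₃'` (its `¬ Addv` binder is vacuous-free: not used), acc1's reduction-free END
(`deepUpper_datum_of_poitouTate_of_port_e_deep`) fed §1's port family.  NO reduction-type case split, NO PORT″,
NO stub, NO (C3), NO (DD), NO Manin / period / `c₃` / local-torsion hypothesis.
[cite: Kim2025RefinedTNC, Thm 1.1] [cite: Kim2022StructureSelmer, Thm. 3.13, Lemma 3.4 and §2.2.2]
[cite: Sakamoto2024, Thm. 4.4 (1)(2) (p. 926)] [cite: MilneADT2006, Ch. I, Thm. 4.10]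
[cite: Kato2004Asterisque, (8.1.3), §9.4, Thm. 9.7 and Ex. 13.3] -/
theorem deepUpper_optimalRow_of_deepFacts_of_fineKatoUniform
    (hS24d : S24Deep.kolyvaginSystems_freeRankOne_zmod_three_pow_deep)
    (hS24d₂ : S24Deep.kolyvaginSystems_idealOfBasis_eq_fittingIdeal_zmod_three_pow_deep)
    (hGZK : rank_eq_analyticRank_of_analyticRank_le_one)
    (hPT : poitouTate_selmerStructure_duality ℚ) :
    ∀ (W₀ : WeierstrassCurve ℚ) [W₀.IsElliptic] [W₀.IsGloballyMinimal],
      (∀ n : ℕ, W₀.HasSurjectiveModNGaloisRep (3 ^ n : ℕ)) → Finite W₀.sha →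
      ∀ {N : ℕ} [NeZero N], N = W₀.conductorNorm ℤ →
      ∀ (D₀ : Literature.NumberTheory.EllipticCurves.ModularForms.ModularParametrizationData W₀ N),
        (∀ z ∈ D₀.L.lattice, ∃ w ∈ Literature.NumberTheory.EllipticCurves.ModularForms.periodLattice D₀.f, z = D₀.c * w) →
        (∀ r : ℚ, Literature.NumberTheory.EllipticCurves.ratPlusSymbol D₀.f r ≠ 0 →
          0 ≤ padicValRat 3 (Literature.NumberTheory.EllipticCurves.ratPlusSymbol D₀.f r)) →
        Literature.NumberTheory.EllipticCurves.kuriharaVanishingOrder W₀ 3 D₀.f = 0 →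
        ∃ d : ℕ, Literature.NumberTheory.EllipticCurves.kuriharaPartialDeepInfty W₀ 3 D₀.f = d ∧
          ((padicValNat 3 (Nat.card (AddCommGroup.primaryComponent W₀.sha 3)) + d : ℕ) : ℕ∞) ≤
            Literature.NumberTheory.EllipticCurves.kuriharaPartial W₀ 3 D₀.f 0 := by
  intro W₀ _ _ htow _ N _ hN D₀ hopt hint hord
  obtain ⟨v₃, η, hv₃, hη⟩ := KimAtThreeShallowEqDeepSplitGlueNoStub.exists_place_three_and_generators
  obtain ⟨t, e, hPort⟩ := portFamilyDeep_of_fineKatoUniform hC1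
    (fun W _ _ htow' _ _ P _ _ => certSupply_uniform W htow' P) W₀ htow v₃ hv₃ η hη D₀ hN hopt
  exact deepUpper_datum_of_poitouTate_of_port_e_deep hS24d hS24d₂ hGZK hPT W₀ htow D₀ hint hord v₃ hv₃ η
    hη t e hPort

/-- ★ **Crux `DeepUpperAtThree` (stmt-BirchSwinnertonDyer-19076) BY NAME from S24-DEEP ×2, GZK, Poitou–Tate,
Carayol and the ONE uniform fine Kato package (C1ᵤ)** — kim3's transport to optimal data at the conductor
(`deepUpperAtThree_of_forall_optimalDatum_atConductor`) fed the row theorem.  NO Kato-stratum / off-stratum split,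
NO PORT″ / stub / (C3), NO (DD) / Wuthrich / BSD₃, NO pinned-Sakamoto facts.  Conditional; nothing is booked.
[cite: Kim2025RefinedTNC, Thm 1.1] [cite: Sakamoto2024, Thm. 4.4 (p. 926)] [cite: Carayol1986]
[cite: Kato2004Asterisque, (8.1.3) (p. 180), §9.4 and Thm. 9.7 (pp. 188–189), Ex. 13.3 (pp. 224–225)] [cite: MilneADT2006, Ch. I, Thm. 4.10] -/
theorem deepUpperAtThree_of_deepFacts_of_fineKatoUniform
    (hlev : CarayolLevelEqConductor)
    (hS24d : S24Deep.kolyvaginSystems_freeRankOne_zmod_three_pow_deep)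
    (hS24d₂ : S24Deep.kolyvaginSystems_idealOfBasis_eq_fittingIdeal_zmod_three_pow_deep)
    (hGZK : rank_eq_analyticRank_of_analyticRank_le_one)
    (hPT : poitouTate_selmerStructure_duality ℚ) :
    Summit.BirchSwinnertonDyer.BirchSwinnertonDyer.Theses.KimAtThreeKolyvagin.DeepUpperAtThree :=
  KimAtThreeKolyvaginIsogenyCruxes.deepUpperAtThree_of_forall_optimalDatum_atConductor hlev
    fun W₀ _ _ htow hfin _ _ hN D₀ hopt _ hint hord =>
      deepUpper_optimalRow_of_deepFacts_of_fineKatoUniform hC1 hS24d hS24d₂ hGZK hPT W₀ htow hfin hN D₀ hopt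
        hint hord

end Uniform

end Summit.BirchSwinnertonDyer.BirchSwinnertonDyer.Theorems.KimAtThreeDeepUpperUniformOfFineKato

end
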